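import Literature.NumberTheory.EllipticCurves.ThreeDivisionFieldSwanProofs
import Literature.NumberTheory.GaloisRepresentations.HasseArfProofs
import Literature.NumberTheory.GaloisRepresentations.CentralInvolutionBreakProofs
import Literature.NumberTheory.GaloisRepresentations.ArtinConductorIntegralityProofs
import Literature.NumberTheory.GaloisRepresentations.RamificationFiltrationTowerProofs
import HarnessLib

/-!
# Crux `FreyModularity` (stmt-ABC-11340), line `Sketch`: an odd Swan conductor of `E[3]` above `2`
# forces a non-abelian inertia action on `E[3]`

Support file for the crux `Summit.ABC.ABC.Theses.DefiniteXi.FreyModularity` (every Frey curve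
`E_(a,b) : y² = x(x - a)(x + b)` is modular), line `Sketch`, registered stub
`stub_swanOddNonabelianInertia`.  It is the parity half of the observation "case B of the
composition (no framed model of `E[3]` absolutely irreducible over `ℚ(√-3)`) forces the Frey curve
to be semistable": for an elliptic curve `E` over a number field `K`, a place `v ∣ 2` and a prime
`𝔓 ∣ v` of `\bar ℤ_K`, **if the inertia group `I_𝔓` acts on `E[3]` through an abelian group then
the Swan conductor `Sw_𝔓(E[3])` is even** (`exists_swanConductorAt_torsion_three_eq_two_mul_of_forall_comm`);
contrapositively an odd Swan conductor produces two elements of `I_𝔓` whose actions on `E[3]` do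
not commute (the stub, over `ℚ`).

The argument (Diamond–Kramer 1995, Lemma 3 / Ribet 1997, proof of Prop. 1, run for the inertia
group instead of a stable line): `det ρ̄_{E,3} = χ̄₃` is unramified above `2`, so inertia acts
through `SL₂(𝔽₃)`, whose only involution is `-1`; hence every non-trivial wild ramification group
fixes no point of `E[3]` and `Sw_𝔓(E[3]) = 2 φ_{L/K}(b)` where `L = K(E[3])`, `ι ∈ G₁` is the
central involution and `i_G(ι) = b + 1` (the tree's
`swanConductorAt_torsion_eq_two_mul_herbrandPhi`, `exists_central_involution_divisionField_three`).
If `G₀ = Gal(L/K)_{𝔓,0}` is abelian, a character `θ` of `G₀` with `θ(ι) ≠ 1` exists, and the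
Hasse–Arf theorem in Serre's subgroup form (`card_inf_inertia_dvd_finsum_card_inf_ramificationSubgroup_holds`,
Serre *Local Fields* VI §2 Prop. 5 Cor.) gives `#G₀ ∣ Σ_{i ≤ b} #G_i`, i.e. `φ_{L/K}(b) ∈ ℕ`
(`exists_natCast_eq_herbrandPhi_of_dvd`); so `Sw_𝔓(E[3]) ∈ 2ℕ`.

Nothing is defined; no named fact is used.

## References

* [DiamondKramer1995] F. Diamond, K. Kramer, *Modularity of a family of elliptic curves*,
  Math. Res. Lett. 2 (1995), 299–304, Lemma 3 and the remark following it.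
* [Ribet1997] K. A. Ribet, *On the equation aᵖ + 2^α bᵖ + cᵖ = 0*, Acta Arith. 79 (1997), proof
  of Prop. 1 (pp. 11–12).
* [SerreLocalFields1979] J.-P. Serre, *Local Fields*, GTM 67 (1979), Ch. IV §3 (Hasse–Arf),
  Ch. VI §2 Prop. 5 and Corollary.
-/

-- `Summit.<Summit>.<Problem>` is the mandated summit-side namespace (CONVENTIONS §2); for the
-- single-conjunct summit `ABC` the two coincide, so the duplicate `ABC.ABC` is deliberate.
set_option linter.dupNamespace false

noncomputable section

open scoped Classical NumberField

open Field IsDedekindDomain MeasureTheory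
open Literature.NumberTheory.EllipticCurves Literature.NumberTheory.GaloisRepresentations
open WeierstrassCurve

attribute [local instance] AddSubgroup.torsionBy.zmodModule

namespace Summit.ABC.ABC.Theorems

universe u

variable {K : Type u} [Field K] [NumberField K]

/-- **Abelian inertia action on `E[3]` ⇒ `Sw_𝔓(E[3])` is even** (`𝔓 ∣ v ∣ 2`).  Let
`L = K(E[3])`, `G = Gal(L/K)`, `G_i` the ramification groups of `𝔓 ∩ L`.  If `G₁ = 1` the
representation is tame at `𝔓` and `Sw = 0`.  Otherwise the central involution `ι ∈ G₁` (acting as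
`-1`, `exists_central_involution_divisionField_three`) lies in every non-trivial `G_i`
(`mem_zpowers_of_mem_ramificationSubgroup_one`), so with `i_G(ι) = b + 1` one has `G_i ≠ 1 ↔ i ≤ b`
for `i ≥ 1` and `Sw_𝔓(E[3]) = 2 φ_{L/K}(b)` (`swanConductorAt_torsion_eq_two_mul_herbrandPhi`).
If the inertia group of `Γ_K` at `𝔓` acts on `E[3]` through commuting operators, `G₀` is abelian
(it is the image of that inertia group, `inertia_comap_le_range_absRestrictNormalHom`, and `G`
acts faithfully on `E[3]`), a character `θ : G₀ → ℂˣ` with `θ(ι) ≠ 1` exists, and Serre's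
subgroup form of Hasse–Arf (`card_inf_inertia_dvd_finsum_card_inf_ramificationSubgroup_holds`)
reads `#G₀ ∣ Σ_{i=0}^{b} #G_i`, whence `φ_{L/K}(b) ∈ ℕ` (`exists_natCast_eq_herbrandPhi_of_dvd`).
[cite: DiamondKramer1995, Lemma 3] [cite: SerreLocalFields1979, Ch. VI §2 Prop. 5 and Corollary] -/
theorem exists_swanConductorAt_torsion_three_eq_two_mul_of_forall_comm (W : WeierstrassCurve K)
    [W.IsElliptic] {v : HeightOneSpectrum (𝓞 K)} (hv2 : (2 : 𝓞 K) ∈ v.asIdeal)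
    (h3 : ((3 : ℕ) : 𝓞 K) ∉ v.asIdeal) {𝔓 : Ideal (absIntegers (𝓞 K) K)}
    (h𝔓 : 𝔓 ∈ v.primesAbove)
    (hcomm : ∀ σ₁ ∈ 𝔓.inertia (absoluteGaloisGroup K), ∀ σ₂ ∈ 𝔓.inertia (absoluteGaloisGroup K),
      ∀ T : geomTorsion W (3 : ℕ), (σ₁ * σ₂) • T = (σ₂ * σ₁) • T) :
    ∃ n : ℕ, (W.torsionGaloisRep 3).swanConductorAt (𝓞 K) 𝔓 = 2 * n := by
  haveI : Fact (Nat.Prime 3) := ⟨Nat.prime_three⟩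
  haveI : 𝔓.IsPrime := h𝔓.1
  haveI h𝔓max : 𝔓.IsMaximal := HeightOneSpectrum.isMaximal_of_mem_primesAbove h𝔓
  set L : IntermediateField K (AlgebraicClosure K) := W.divisionField 3 with hLdef
  haveI : IsGalois K L := {}
  set 𝔓L := 𝔓.comap (L.integralClosureToAbsIntegers (𝓞 K)) with h𝔓L
  haveI hmaxL : 𝔓L.IsMaximal := isMaximal_comap_integralClosureToAbsIntegers (𝓞 K) 𝔓 L
  haveI : Finite ((𝓞 K) ⧸ 𝔓.under (𝓞 K)) := by
    rw [← h𝔓.2.over]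
    exact Ideal.finiteQuotientOfFreeOfNeBot v.asIdeal v.ne_bot
  haveI hsepL : Algebra.IsSeparable ((𝓞 K) ⧸ 𝔓L.under (𝓞 K)) (integralClosure (𝓞 K) L ⧸ 𝔓L) :=
    isSeparable_residue_comap (𝓞 K) 𝔓 L
  -- `Gal(L/K)` acts faithfully on `E[3]`
  have hL : ∀ σ : absoluteGaloisGroup K, absRestrictNormalHom L σ = 1 →
      ∀ T : geomTorsion W (3 : ℕ), σ • T = T :=
    fun σ h ↦ (W.absRestrictNormalHom_divisionField_eq_one_iff 3 σ).mp h
  have hLf : ∀ σ : absoluteGaloisGroup K, (∀ T : geomTorsion W (3 : ℕ), σ • T = T) →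
      absRestrictNormalHom L σ = 1 :=
    fun σ h ↦ (W.absRestrictNormalHom_divisionField_eq_one_iff 3 σ).mpr h
  by_cases hG1 : 𝔓L.ramificationSubgroup (L ≃ₐ[K] L) 1 = ⊥
  · -- tame case: every wild group `Γ_K^u`, `u > 0`, acts trivially on `E[3]`, so `Sw = 0`
    refine ⟨0, ?_⟩
    rw [Nat.cast_zero, mul_zero]
    refine GaloisRep.IsTameAt.swanConductorAt_eq_zero fun u hu σ hσ ↦ ?_
    have hres : absRestrictNormalHom L σ ∈ upperRamificationSubgroup 𝔓L (L ≃ₐ[K] L) u :=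
      absUpperRamificationSubgroup_map_absRestrictNormalHom_le 𝔓 L u ⟨σ, hσ, rfl⟩
    have h1 : absRestrictNormalHom L σ = 1 := by
      have h := upperRamificationSubgroup_le_ramificationSubgroup_one 𝔓L (L ≃ₐ[K] L) hu hres
      rwa [hG1, Subgroup.mem_bot] at h
    exact LinearMap.ext fun T ↦ by
      rw [torsionGaloisRep_apply, hL σ h1 T, Module.End.one_apply]
  -- wild case: the central involution `ι ∈ G₁`
  obtain ⟨ι, hιG1, hι1, -, hι⟩ := W.exists_central_involution_divisionField_three hv2 h3 h𝔓 hG1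
  have hgen := W.mem_zpowers_of_mem_ramificationSubgroup_one 3 hv2 h3 h𝔓 L hL hLf hι
  -- `i_G(ι) = b + 1` with `b ≥ 1`
  obtain ⟨N, hN⟩ := ramificationSubgroup_comap_eventually_eq_bot (𝓞 K) 𝔓 L
  obtain ⟨m, hm⟩ := ENat.ne_top_iff_exists.mp (lowerIndex_ne_top 𝔓L (hN N le_rfl) hι1)
  have hm2 : 2 ≤ m := by
    have h := (add_one_le_lowerIndex_iff 𝔓L (G := L ≃ₐ[K] L) (s := ι) (i := 1)).mpr hιG1
    rw [← hm] at h
    have h' : ((1 + 1 : ℕ) : ℕ∞) ≤ (m : ℕ∞) := by push_cast; exact h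
    exact_mod_cast h'
  obtain ⟨b, rfl⟩ : ∃ b : ℕ, m = b + 1 := ⟨m - 1, by omega⟩
  have hb : lowerIndex 𝔓L (L ≃ₐ[K] L) ι = b + 1 := by rw [← hm]; push_cast; rfl
  -- `Sw_𝔓(E[3]) = 2 φ_{L/K}(b)`
  have key := W.swanConductorAt_torsion_eq_two_mul_herbrandPhi 3 hv2 h3 h𝔓 L hL hLf hι hb
  -- `G_i ≠ 1 ↔ i ≤ b` (`i ≥ 1`) and `ι ∈ G_i` for `i ≤ b`
  have hlast : ∀ i, 1 ≤ i → (𝔓L.ramificationSubgroup (L ≃ₐ[K] L) i ≠ ⊥ ↔ i ≤ b) :=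
    fun i hi ↦ ramificationSubgroup_ne_bot_iff_le_of_lowerIndex_eq 𝔓L hι1 hgen hb hi
  have hιmem : ∀ i, i ≤ b → ι ∈ 𝔓L.ramificationSubgroup (L ≃ₐ[K] L) i := by
    intro i hi
    rcases Nat.eq_zero_or_pos i with rfl | hpos
    · exact 𝔓L.ramificationSubgroup_antitone (L ≃ₐ[K] L) (Nat.zero_le 1) hιG1
    · exact (ramificationSubgroup_ne_bot_iff_mem_of_forall_mem_zpowers 𝔓L hι1 hgen hpos).mp
        ((hlast i hpos).mpr hi)
  -- the inertia group `G₀` of `𝔓 ∩ L` is abelian: it is the image of `I_𝔓`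
  set H : Subgroup (L ≃ₐ[K] L) := 𝔓L.inertia (L ≃ₐ[K] L) with hH
  have hab : ∀ a c : H, a * c = c * a := by
    rintro ⟨a, ha⟩ ⟨c, hc⟩
    obtain ⟨⟨σ₁, hσ₁⟩, rfl⟩ := inertia_comap_le_range_absRestrictNormalHom 𝔓 L ha
    obtain ⟨⟨σ₂, hσ₂⟩, rfl⟩ := inertia_comap_le_range_absRestrictNormalHom 𝔓 L hc
    apply Subtype.ext
    change absRestrictNormalHom L σ₁ * absRestrictNormalHom L σ₂ =
      absRestrictNormalHom L σ₂ * absRestrictNormalHom L σ₁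
    rw [← map_mul, ← map_mul, ← inv_mul_eq_one, ← map_inv, ← map_mul]
    refine hLf _ fun T ↦ ?_
    rw [mul_smul, inv_smul_eq_iff]
    exact (hcomm σ₁ hσ₁ σ₂ hσ₂ T).symm
  -- a character `θ` of `G₀` with `θ ι ≠ 1`
  have hιH : ι ∈ H := by
    rw [hH, ← Ideal.ramificationSubgroup_zero]
    exact hιmem 0 (Nat.zero_le b)
  haveI : Finite H := inferInstance
  obtain ⟨θ, -, hθι⟩ := exists_monoidHom_apply_ne_one_of_comm hab ⊥ (g := ⟨ι, hιH⟩)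
    (by rw [Subgroup.mem_bot]; exact fun h ↦ hι1 (congrArg Subtype.val h))
  -- Hasse–Arf, subgroup form: `#G₀ ∣ Σ_{i ≤ b} #G_i`
  have hHA := card_inf_inertia_dvd_finsum_card_inf_ramificationSubgroup_holds (𝓞 K) (K := K)
    (L := L) 𝔓L H θ
  have hinf : ∀ i, H ⊓ 𝔓L.ramificationSubgroup (L ≃ₐ[K] L) i =
      𝔓L.ramificationSubgroup (L ≃ₐ[K] L) i :=
    fun i ↦ inf_eq_right.mpr (𝔓L.ramificationSubgroup_le_inertia (L ≃ₐ[K] L) i)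
  have hH0 : H ⊓ 𝔓L.inertia (L ≃ₐ[K] L) = 𝔓L.ramificationSubgroup (L ≃ₐ[K] L) 0 := by
    rw [hH, inf_idem, Ideal.ramificationSubgroup_zero]
  have hterm : ∀ i, (if (H ⊓ 𝔓L.ramificationSubgroup (L ≃ₐ[K] L) i).subgroupOf H ≤ θ.ker then 0
      else Nat.card ↥(H ⊓ 𝔓L.ramificationSubgroup (L ≃ₐ[K] L) i)) =
      if i ≤ b then Nat.card (𝔓L.ramificationSubgroup (L ≃ₐ[K] L) i) else 0 := by
    intro i
    rw [hinf i]
    by_cases hi : i ≤ b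
    · rw [if_pos hi, if_neg]
      intro hle
      apply hθι
      have hmem : (⟨ι, hιH⟩ : H) ∈ (𝔓L.ramificationSubgroup (L ≃ₐ[K] L) i).subgroupOf H :=
        Subgroup.mem_subgroupOf.mpr (hιmem i hi)
      exact hle hmem
    · rw [if_neg hi, if_pos]
      have hi1 : 1 ≤ i := by omega
      have hbot : 𝔓L.ramificationSubgroup (L ≃ₐ[K] L) i = ⊥ := by
        by_contra hne
        exact hi ((hlast i hi1).mp hne)
      rw [hbot, Subgroup.bot_subgroupOf]
      exact bot_le
  have hsum : (∑ᶠ i : ℕ, if (H ⊓ 𝔓L.ramificationSubgroup (L ≃ₐ[K] L) i).subgroupOf H ≤ θ.ker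
      then 0 else Nat.card ↥(H ⊓ 𝔓L.ramificationSubgroup (L ≃ₐ[K] L) i)) =
      ∑ i ∈ Finset.range (b + 1), Nat.card (𝔓L.ramificationSubgroup (L ≃ₐ[K] L) i) := by
    rw [finsum_congr hterm, finsum_eq_sum_of_support_subset _ (s := Finset.range (b + 1))]
    · refine Finset.sum_congr rfl fun i hi ↦ ?_
      rw [if_pos (Nat.lt_succ_iff.mp (Finset.mem_range.mp hi))]
    · intro i hi
      rw [Function.mem_support] at hi
      rw [Finset.coe_range, Set.mem_Iio, Nat.lt_succ_iff]
      by_contra h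
      exact hi (if_neg h)
  rw [hH0, hsum] at hHA
  obtain ⟨n, hn⟩ := exists_natCast_eq_herbrandPhi_of_dvd (𝓞 K) 𝔓L b hHA
  exact ⟨n, by rw [key, ← hn]⟩

/-- **Registered stub `stub_swanOddNonabelianInertia` (crux `FreyModularity`, line `Sketch`):
an odd Swan conductor of `E[3]` above `2` makes two inertia elements act on `E[3]` without
commuting.**  For an elliptic curve `E/ℚ`, the place `v ∋ 2` and a prime `𝔓 ∣ v` of `\bar ℤ`: if
`Sw_𝔓(E[3])` is not of the form `2n`, there are `σ₁, σ₂ ∈ I_𝔓` and `T ∈ E[3]` with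
`σ₁σ₂ T ≠ σ₂σ₁ T` — the contrapositive of
`exists_swanConductorAt_torsion_three_eq_two_mul_of_forall_comm` over `ℚ` (`3 ∉ v` since `2 ∈ v`).
In the crux this is applied to the additive Frey classes (normalised `A ≡ -1 (mod 4)`, `2 ∣ B`,
`16 ∤ B`), whose Swan conductor above `2` is `1` or `3` (`stub_freySwanOdd`, Diamond–Kramer 1995,
Lemma 2): their inertia image in `SL₂(𝔽₃)` is non-abelian, hence quaternion.
[cite: DiamondKramer1995, Lemma 3] -/
theorem stub_swanOddNonabelianInertia :
    ∀ (W : WeierstrassCurve ℚ) [W.IsElliptic] (v : HeightOneSpectrum (𝓞 ℚ)),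
      (2 : 𝓞 ℚ) ∈ v.asIdeal → ∀ 𝔓 ∈ v.primesAbove,
      (¬ ∃ n : ℕ, (W.torsionGaloisRep 3).swanConductorAt (𝓞 ℚ) 𝔓 = 2 * n) →
      ∃ σ₁ ∈ 𝔓.inertia (Field.absoluteGaloisGroup ℚ), ∃ σ₂ ∈ 𝔓.inertia (Field.absoluteGaloisGroup ℚ),
        ∃ T : geomTorsion W (3 : ℕ), (σ₁ * σ₂) • T ≠ (σ₂ * σ₁) • T := by
  intro W _ v hv2 𝔓 h𝔓 hodd
  by_contra h
  push Not at h
  refine hodd (exists_swanConductorAt_torsion_three_eq_two_mul_of_forall_comm W hv2 ?_ h𝔓 h)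
  -- `3 ∉ v`: otherwise `1 = 3 - 2 ∈ v`
  intro h3
  have h1 : (1 : 𝓞 ℚ) ∈ v.asIdeal := by
    have := v.asIdeal.sub_mem h3 hv2
    push_cast at this
    convert this using 1
    norm_num
  exact v.isPrime.ne_top ((Ideal.eq_top_iff_one _).mpr h1)

end Summit.ABC.ABC.Theorems

end
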